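import Summits.ABC.ABC.Theses.DefiniteXi
import Literature.NumberTheory.EllipticCurves.ManinConstantArbitraryParametrizationIntegralProofs
import Literature.NumberTheory.EllipticCurves.PastenSpectralDegreeIsogenyBoundProofs
import Literature.NumberTheory.EllipticCurves.PastenHeightBoundsLemma68LocalProofs
import Literature.NumberTheory.EllipticCurves.OpenImageMazurAssemblyProofs
import Literature.NumberTheory.EllipticCurves.SemistableModPImageReducibleProofs
import Literature.NumberTheory.EllipticCurves.OpenImageMazurNumericsProofs
import Literature.NumberTheory.EllipticCurves.CyclicIsogenyCharacterFrobeniusProofs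
import Literature.NumberTheory.EllipticCurves.SupersingularDensitySerreFrobeniusProofs
import Literature.NumberTheory.EllipticCurves.BurungaleCastellaSkinner2025.VexingPrimesMultiplicativeProofs
import Literature.NumberTheory.EllipticCurves.KenkuMinimalLevels
import HarnessLib

/-!
# Stub-ideation sketch (k = 2, RESHAPE family) for `stub_pasten163` of crux `DefiniteRTControlPrime`

Elaboration-only sanity file for the helper-lemma signatures named in
`STUB-IDEAS-stub_pasten163-2.md`.  Nothing here is a proof; `sorry` marks helper lemmas a stub
prover would have to supply.  The stub itself is NOT re-typed.
-/

noncomputable section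

open scoped Classical NumberField
open IsDedekindDomain NumberField

namespace Summit.ABC.ABC.Cruxes.DefiniteRTControlPrime.StubIdeasK2

open Summit.ABC.ABC.Theses.DefiniteXi
open Literature.NumberTheory.EllipticCurves Literature.NumberTheory.EllipticCurves.ModularForms
open Literature.NumberTheory.Automorphic
open WeierstrassCurve

/-! ## Plan 1 (TOP) — named-fact leaf: the stub is one line over Mazur–Kenku -/

/-- P1-H0: the stub, closed over the tree's named fact `mazurKenku_exists_cyclic_isogeny`. -/
example (hMK : mazurKenku_exists_cyclic_isogeny) : PastenShimura2024_minimalDegree_le_163_mul :=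
  PastenShimura2024_minimalDegree_le_163_mul_of_mazurKenku' hMK

/-- P1-H0': the sibling stub `stub_pastenLemma68` closes over the SAME hypothesis. -/
example (hMK : mazurKenku_exists_cyclic_isogeny) : PastenShimura2024_lemma_6_8 :=
  PastenShimura2024_lemma_6_8_of_mazurKenku' hMK

/- P1-H0'': the crux modulo {Takahashi 2.3 (coprime form), Mazur–Kenku} is ALREADY LANDED
(p97354, `Summits/ABC/ABC/Theorems/DefiniteXiDefiniteRTControlPrime.lean`, not yet in the farm
snapshot, hence not imported here):
  `Summit.ABC.ABC.Theorems.DefiniteRTControlPrime.definiteRTControlPrime_of_mazurKenku hT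
     (PastenShimura2024_minimalDegree_le_163_mul_of_mazurKenku' hMK) hMK : DefiniteRTControlPrime`. -/

/-- P1-check: the stub is EQUIVALENT to the lattice form of Mazur–Kenku-with-integrality
(tree: `PastenShimura2024_minimalDegree_le_163_mul_iff`), so no discharge cheaper than `hMK`
exists for the stub AS TYPED. -/
example : PastenShimura2024_minimalDegree_le_163_mul ↔
    ∀ {N : ℕ} [NeZero N] {W' : WeierstrassCurve ℚ} [W'.IsElliptic] [W'.IsGloballyMinimal]
      (D' : ModularParametrizationData W' N),
      ∃ (k : ℤ) (hk : ∀ z ∈ periodLattice D'.f, (k : ℂ) * z ∈ D'.L.lattice), k ≠ 0 ∧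
        Nat.card (mulQuotientMap (periodLattice D'.f) D'.L.lattice.toAddSubgroup (k : ℂ) hk).ker
          ≤ 163 :=
  PastenShimura2024_minimalDegree_le_163_mul_iff

/-! ## Plan 2 (RESHAPE, family 2) — the consumed instance with an `N^ε` loss -/

/-- P2-S: the reshaped stub = the ONLY instance the skeleton consumes (line 212 of
`Lines/Sketch.lean`: `W' = C • freyCurve a b` globally minimal, `N` = conductor), with the constant
`163` weakened to `K_ε N^ε`.  Equivalent (by `deg D' = d · deg D`, `d` = minimal cyclic isogeny
degree `W → W'`, tree: proof of `PastenShimura2024_minimalDegree_le_163_mul_iff`) to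
`d(A_f-optimal, E_(a,b)) ≤ K_ε N^ε`. -/
def FreyMinimalDegreeLoss : Prop :=
  ∀ ε : ℝ, 0 < ε → ∃ K : ℝ, ∀ (N : ℕ) [NeZero N] (W W' : WeierstrassCurve ℚ) [W.IsElliptic]
    [W'.IsElliptic] [W'.IsGloballyMinimal] (a b : ℤ) (C : VariableChange ℚ),
    IsCoprime a b → a * b * (a + b) ≠ 0 → W' = C • freyCurve a b → W'.conductorNorm ℤ = N →
    ∀ (D : ModularParametrizationData W N) (D' : ModularParametrizationData W' N),
    D'.f = D.f →
      (∀ (W'' : WeierstrassCurve ℚ) [W''.IsElliptic] (D'' : ModularParametrizationData W'' N),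
          D''.f = D.f → D.modularDegree ≤ D''.modularDegree) →
        (∀ D'' : ModularParametrizationData W' N, D'.modularDegree ≤ D''.modularDegree) →
          (D'.modularDegree : ℝ) ≤ K * (N : ℝ) ^ ε * D.modularDegree

/-- P2-H1 (numerics, Lucas identity `V_n² − (t² − 4ℓ)·U_n² = 4ℓⁿ`): `|α^n + β^n| ≤ 2 ℓ^{n/2}`. -/
theorem frobTracePow_sq_le_four_mul_pow (t ℓ : ℤ) (hℓ : 0 ≤ ℓ) (ht : t ^ 2 ≤ 4 * ℓ) (n : ℕ) :
    Mazur1978.frobTracePow t ℓ n ^ 2 ≤ 4 * ℓ ^ n := by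
  sorry

/-- P2-H2 (numerics): the "trace norm" `n(ℓ,t) := 1 + ℓ¹² − s₁₂(t,ℓ)` is a POSITIVE integer
`≤ (ℓ⁶ + 1)²` (from H1 with `n = 12`: `(ℓ⁶ − 1)² ≤ n(ℓ,t) ≤ (ℓ⁶ + 1)²`). -/
theorem traceNorm_pos_le (t : ℤ) (ℓ : ℕ) (hℓ : 2 ≤ ℓ) (ht : t ^ 2 ≤ 4 * (ℓ : ℤ)) :
    0 < 1 + (ℓ : ℤ) ^ 12 - Mazur1978.frobTracePow t ℓ 12 ∧
      1 + (ℓ : ℤ) ^ 12 - Mazur1978.frobTracePow t ℓ 12 ≤ ((ℓ : ℤ) ^ 6 + 1) ^ 2 := by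
  sorry

/-- P2-H3 (the Mazur-free lever, uniform-trace form): an odd prime `p` at which `W` is
semistable (good or multiplicative) and with `E[p]` reducible divides the SAME integer
`n(ℓ) = 1 + ℓ¹² − s₁₂(a_ℓ(W), ℓ)` for every odd good prime `ℓ ≠ p`.  Chain (all in tree):
`not_hasIrreducibleModPGaloisRep_iff_exists_natCard_eq` → `exists_isogenyCharacter` →
`exists_forall_isogenyCharacter_eq_mul_pow` (`r = b·χ̄ᵏ`, `b¹² = 1`) →
`modEq_zero_or_one_of_hasGoodReductionAtPrime` / `modEq_zero_or_one_of_hasMultiplicativeReductionAt`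
(`k ≡ 0, 1 mod p − 1`) → `cyclicCharacter_sq_sub_frobeniusTrace_mul_add_eq_zero` (k := 1) at an
arithmetic Frobenius above `ℓ` → `frobTracePow_spec` + Fermat. -/
theorem dvd_traceNorm_of_not_irreducible (W : WeierstrassCurve ℚ) [W.IsElliptic]
    [W.IsGloballyMinimal] (p : ℕ) [Fact p.Prime] (hp2 : p ≠ 2)
    (hsemi : W.HasGoodReductionAtPrime p ∨
      ∃ v : HeightOneSpectrum (𝓞 ℚ), (Rat.HeightOneSpectrum.primesEquiv v : ℕ) = p ∧
        W.HasMultiplicativeReductionAt v)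
    (hred : ¬ W.HasIrreducibleModPGaloisRep p)
    (ℓ : ℕ) [Fact ℓ.Prime] (hℓ2 : ℓ ≠ 2) (hℓp : ℓ ≠ p) (hgood : W.HasGoodReductionAtPrime ℓ) :
    (p : ℤ) ∣ 1 + (ℓ : ℤ) ^ 12 - Mazur1978.frobTracePow (W.frobeniusTrace ℓ) ℓ 12 := by
  sorry

/-- P2-H3' (Hasse at `ℓ`, in tree): the trace fed to H2. -/
example (W : WeierstrassCurve ℚ) [W.IsElliptic] [W.IsGloballyMinimal] (ℓ : ℕ) [Fact ℓ.Prime]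
    (hgood : W.HasGoodReductionAtPrime ℓ) : W.frobeniusTrace ℓ ^ 2 ≤ 4 * ℓ :=
  frobeniusTrace_sq_le_four_mul W ℓ hgood

/-- P2-H4 (radical bound = H2 + H3 + `Finset.prod_primes_dvd`): the product of the odd
semistable reducible primes of `W` is at most `(ℓ⁶ + 1)²` for ANY odd good prime `ℓ` outside the
set. -/
theorem prod_reduciblePrimes_le (W : WeierstrassCurve ℚ) [W.IsElliptic] [W.IsGloballyMinimal]
    (S : Finset ℕ) (hS : ∀ p ∈ S, p.Prime ∧ p ≠ 2 ∧ ¬ W.HasIrreducibleModPGaloisRep p ∧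
      (∀ [Fact p.Prime], W.HasGoodReductionAtPrime p ∨
        ∃ v : HeightOneSpectrum (𝓞 ℚ), (Rat.HeightOneSpectrum.primesEquiv v : ℕ) = p ∧
          W.HasMultiplicativeReductionAt v))
    (ℓ : ℕ) [Fact ℓ.Prime] (hℓ2 : ℓ ≠ 2) (hℓS : ℓ ∉ S) (hgood : W.HasGoodReductionAtPrime ℓ) :
    ∏ p ∈ S, p ≤ (ℓ ^ 6 + 1) ^ 2 := by
  sorry

/-- P2-H5 (elementary, Bertrand + `m! ≤ N`): a small odd prime not dividing `N`. -/
theorem exists_small_odd_prime_not_dvd : ∀ ε : ℝ, 0 < ε → ∃ C : ℝ, ∀ N : ℕ, 1 ≤ N →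
    ∃ ℓ : ℕ, ℓ.Prime ∧ ℓ ≠ 2 ∧ ¬ ℓ ∣ N ∧ (ℓ : ℝ) ≤ C * (N : ℝ) ^ ε := by
  sorry

/-- P2-H6 (Frey input, in tree modulo the landed `stub_freyLocal`): `q ∥ N` gives multiplicative
reduction at the place of `𝓞 ℚ` above `q`. -/
example (W : WeierstrassCurve ℚ) [W.IsElliptic] (v : HeightOneSpectrum (𝓞 ℚ))
    (hv : (W.conductorNorm ℤ).factorization (Rat.HeightOneSpectrum.primesEquiv v : ℕ) = 1) :
    W.HasMultiplicativeReductionAt v :=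
  BurungaleCastellaSkinner2025.hasMultiplicativeReductionAt_ringOfIntegers_of_factorization_conductorNorm_eq_one
    W v hv

/-- P2-R1 (residual NOT controlled by H1–H6 — recorded, not claimed): exponents.  The `N^ε`
reshape of the stub needs, beyond the radical bound H4, a bound on the EXPONENT of each small odd
prime (and of `2`) in the minimal cyclic isogeny degree of the Frey class; the only known inputs
are the Kenku prime-power levels (tree: `kenku_minimalLevels_mem_kenkuDegrees`, itself over absent
`X₀(p²)` / `X₀(32)` determinations), i.e. the same trust base as Plan 1. Typed here as the
statement a prover would have to supply; NO cheaper source is known (see the md). -/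
def FreyCyclicIsogenyExponentBound : Prop :=
  ∀ ε : ℝ, 0 < ε → ∃ K : ℝ, ∀ (W W' : WeierstrassCurve ℚ) [W.IsElliptic] [W'.IsElliptic]
    (a b : ℤ) (C : VariableChange ℚ), IsCoprime a b → a * b * (a + b) ≠ 0 →
    W' = C • freyCurve a b → IsIsogenous W W' →
      ∃ φ : Isogeny W W', φ.IsCyclic ∧ (φ.degree : ℝ) ≤ K * ((W'.conductorNorm ℤ : ℕ) : ℝ) ^ ε

end Summit.ABC.ABC.Cruxes.DefiniteRTControlPrime.StubIdeasK2

end
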